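import Literature.MathematicalPhysics.PowerSystems.DroopLoadsSolutionExistence

/-!
# Droop-controlled inverters with load nodes: UNIQUENESS of the solution of the
# differential-algebraic closed loop from consistent initial data near the synchronized solution
# — the index-one DAE well-posedness that SPDB2013 Theorem 2 (i)'s «locally exponentially stable»
# presupposes (erratum 2026-08-28: the print's «unique» in Theorem 2 (i) qualifies the SYNCHRONIZED
# SOLUTION in `Δ_G(γ)`, not trajectories; no theorem of this file claims or uses that uniqueness)

Topic `Literature/MathematicalPhysics/PowerSystems` (LADDER-GRIDFUSION rung G3; seat gridfusion-lit-2,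
g13).  Companion of `DroopSyncExponentialStabilityLoads.lean` (Theorem 2 (i) WITH load nodes: every
solution of (KuraDroop)–(PowerBal) starting `ρ`-close converges exponentially to a rotation of the
synchronized solution) and `DroopLoadsSolutionExistence.lean` (from every CONSISTENT initial condition
close to the equilibrium a solution on `[0, ∞)` EXISTS: `exists_syncSolution_loads`).  That file
says «Uniqueness of the DAE solution is not asserted here»; this file proves it, in exactly the
solution class the existence theorem produces: `θ(0) = θ⁰`, (KuraDroop)/(PowerBal) at every `t > 0`
(`IsSolutionAt`), the load constraints at every `t ≥ 0`, `θ` continuous on `[0, ∞)`.  0 named facts.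

THE ARGUMENT (standard index-one DAE uniqueness, made explicit):
* §1 a forward solution, read in the frame rotating at `ω_avg`, is differentiable at every `t > 0`
  with inverter velocities `m_i/D_i` and satisfies the load constraints (`frame_hasDerivAt`,
  `frame_constraint`); where `L_LL(θ(t))` is invertible its velocity IS the Kron-extended field
  `F = kronField θ*` (`hasDerivAt_kronField_of_forward`, by the companion's constraint
  differentiation applied to the curve frozen at negative times);
* §2 **`frame_eq_of_kronSolution`**: a continuous forward curve that solves `ẋ = F(x)` at every
  regular time `t > 0` and starts where a REGULAR solution `X*` of `ẋ = F(x)` starts coincides with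
  `X*` on `[0, ∞)` — first time of disagreement `t₁`, agreement at `t₁` by continuity, a compact
  regular ball around `X*(t₁)` on which `F` is Lipschitz (`C¹` on the open regular set), the right
  derivative at `t₁` by continuous extension of the derivative
  (`hasDerivWithinAt_Ici_of_tendsto_deriv`), and Grönwall (`dist_le_of_trajectories_ODE_of_mem`);
* §3 **`syncSolution_unique_loads`** — TRAJECTORY UNIQUENESS for the DAE closed loop of Theorem 2 (i)
  with load nodes (the well-posedness its stability statement presupposes): `∃ ρ > 0` such that
  two solutions of the differential-algebraic closed loop in the class above with the same initial
  condition `θ⁰`, `‖θ⁰ − θ*‖ < ρ`, coincide for all `t ≥ 0`; with the companion's existence theorem,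
  **`existsUnique_syncSolution_loads`**: from every consistent `θ⁰` with `‖θ⁰ − θ*‖ < ρ` there is
  EXACTLY ONE solution in the class, and it obeys the exponential estimate.

THREE COLUMNS.  Mathematics about the MODEL (KuraDroop)–(PowerBal) (lossless lines, constant voltage
amplitudes, constant-power loads as algebraic rows); solutions are classical (load angles
differentiable for `t > 0`).  Nothing here says a microgrid is stable.

## Mathlib / tree search

Tree (used by name): `DroopNetwork.{exists_kronSolution, contDiffOn_kronField, isOpen_regular,
hasDerivAt_kronField_of_constraint, mismatch_add_const, dc_load, kronField_add_const,
exists_syncSolution_loads, IsSolutionAt, avgFrequency}`,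
`Literature.Analysis.ODE.exists_lipschitzOnWith_of_isCompact`.  Mathlib:
`dist_le_of_trajectories_ODE_of_mem` (Grönwall), `hasDerivWithinAt_Ici_of_tendsto_deriv`
(derivative at an endpoint by continuous extension), `isCompact_closedBall`.

## References

* J. W. Simpson-Porco, F. Dörfler, F. Bullo, *Synchronization and power sharing for droop-controlled
  inverters in islanded microgrids*, Automatica 49 (2013) 2603–2611 = arXiv:1206.5033, §3 Theorem 2
  (i) («locally exponentially stable»; its «unique» qualifies the synchronized solution in `Δ_G(γ)`)
  and proof of (b) (held text p0008 L23–L49: «`θ*` is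
  a regular equilibrium point», «solving the set of `|V_L|` algebraic equations and substituting
  into the dynamics»). [SimpsonporcoDorflerBullo2013]
* E. Hairer, G. Wanner, *Solving ODEs II*, §VI.1 (index-1 systems reduce to ODEs on the constraint
  manifold) — background only; the proof here is self-contained. [folklore]

AI-produced formalisation (LADDER-GRIDFUSION seat gridfusion-lit-2 g13, 2026-08-28).
-/

noncomputable section

open Set Filter Topology Finset Metric
open scoped Matrix BigOperators NNReal

namespace Literature.MathematicalPhysics.PowerSystems

namespace DroopNetwork

variable {n : ℕ} {N : DroopNetwork n}

/-! ## §1 A forward solution in the rotating frame -/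

/-- The frame curve `X(s) = θ(s) − ω_avg s 𝟙` of a solution of (KuraDroop)–(PowerBal) AT TIME `t` is
differentiable at `t` with inverter velocities `Ẋ_i = m_i(X)/D_i`.
[cite: SimpsonporcoDorflerBullo2013, §3 proof of Theorem 2 (eq. (Aux), frame rotating at `ω_avg`)] -/
theorem frame_hasDerivAt (hD : ∀ i, 0 ≤ N.Dc i) {θ : ℝ → Fin n → ℝ} {t : ℝ}
    (hsol : N.IsSolutionAt θ t) :
    ∃ V : Fin n → ℝ, HasDerivAt (fun s j => θ s j - N.avgFrequency * s) V t ∧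
      ∀ i : N.Inv, V i.1 = N.mismatch (fun j => θ t j - N.avgFrequency * t) i.1 / N.Dc i.1 := by
  classical
  have hrot : ∀ j, N.mismatch (fun j => θ t j - N.avgFrequency * t) j = N.mismatch (θ t) j := by
    intro j
    have := congrFun (mismatch_add_const (N := N) (θ t) (-(N.avgFrequency * t))) j
    simpa [sub_eq_add_neg] using this
  choose w hw hDw using fun j => hsol j
  refine ⟨fun j => w j - N.avgFrequency, ?_, fun i => ?_⟩
  · rw [hasDerivAt_pi]
    intro j
    exact (hw j).sub ((hasDerivAt_id t).const_mul N.avgFrequency |>.congr_deriv (by simp))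
  · rw [hrot, mismatch, shiftedInjection]
    have hDi : N.Dc i.1 ≠ 0 := i.2.ne'
    have h0 := hD i.1
    field_simp
    have := hDw i.1
    linarith

/-- The load constraints in the rotating frame: `m_l(X(t)) = 0` whenever `P*_l = P_e,l(θ(t))`.
[cite: SimpsonporcoDorflerBullo2013, §3 eq. (PowerBal)] -/
theorem frame_constraint (hD : ∀ i, 0 ≤ N.Dc i) {θ : ℝ → Fin n → ℝ} {t : ℝ}
    (hcons : ∀ l : N.Load, N.Pstar l.1 = N.injection (θ t) l.1) (l : N.Load) :
    N.mismatch (fun j => θ t j - N.avgFrequency * t) l.1 = 0 := by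
  have hrot : N.mismatch (fun j => θ t j - N.avgFrequency * t) l.1 = N.mismatch (θ t) l.1 := by
    have := congrFun (mismatch_add_const (N := N) (θ t) (-(N.avgFrequency * t))) l.1
    simpa [sub_eq_add_neg] using this
  rw [hrot, mismatch, shiftedInjection, dc_load hD l, hcons l]
  ring

/-- **A forward solution solves the Kron-extended ODE at every regular time `t > 0`.**  Let `X` be
continuous... precisely: if `X` is differentiable at `t > 0` with inverter velocities `m_i(X)/D_i`,
the load constraints hold along `X` on `[0, ∞)`, and `L_LL(X(t))` is invertible, then
`Ẋ(t) = F(X(t))` (`F = kronField θ*`).  (The companion's `hasDerivAt_kronField_of_constraint`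
applied to the curve `s ↦ X(max(s, 0))`, which satisfies the constraints at ALL times.)
[cite: SimpsonporcoDorflerBullo2013, §3 proof of Theorem 2 (b) («solving the set of `|V_L|` algebraic equations and substituting into the dynamics»)] -/
theorem hasDerivAt_kronField_of_forward {θs : Fin n → ℝ} {X : ℝ → Fin n → ℝ} {t : ℝ} (ht : 0 < t)
    {V : Fin n → ℝ} (hV : HasDerivAt X V t)
    (hI : ∀ i : N.Inv, V i.1 = N.mismatch (X t) i.1 / N.Dc i.1)
    (hL : ∀ (l : N.Load) (s : ℝ), 0 ≤ s → N.mismatch (X s) l.1 = 0)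
    (hU : IsUnit (N.lapLL (X t)).det) :
    HasDerivAt X (N.kronField θs (X t)) t := by
  set Y : ℝ → Fin n → ℝ := fun s => X (max s 0) with hY
  have hYX : Y =ᶠ[𝓝 t] X := by
    filter_upwards [Ioi_mem_nhds ht] with s hs
    simp only [hY, max_eq_left (le_of_lt (mem_Ioi.1 hs))]
  have hYt : Y t = X t := by simp only [hY, max_eq_left ht.le]
  have hVY : HasDerivAt Y V t := hV.congr_of_eventuallyEq hYX
  have hIY : ∀ i : N.Inv, V i.1 = N.mismatch (Y t) i.1 / N.Dc i.1 := by rw [hYt]; exact hI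
  have hLY : ∀ (l : N.Load) (s : ℝ), N.mismatch (Y s) l.1 = 0 := fun l s =>
    hL l (max s 0) (le_max_right _ _)
  have hUY : IsUnit (N.lapLL (Y t)).det := by rw [hYt]; exact hU
  have h := hasDerivAt_kronField_of_constraint (θs := θs) hVY hIY hLY hUY
  rw [hYt] at h
  exact h.congr_of_eventuallyEq hYX.symm

/-! ## §2 A continuous forward curve solving the Kron ODE at its regular times coincides with a
regular solution from the same initial point -/

/-- Grönwall-type uniqueness along a regular solution.  `X*` solves `ẋ = F(x)` on every `[0, T]` and
is regular (`det L_LL(X*(t)) ≠ 0`) for all `t ≥ 0`; `X` is continuous on `[0, ∞)`, solves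
`ẋ = F(x)` at every `t > 0` at which it is regular, and `X(0) = X*(0)`.  Then `X = X*` on `[0, ∞)`.
[cite: Khalil2002, Theorem 3.1 (local uniqueness for locally Lipschitz fields); SimpsonporcoDorflerBullo2013, §3 proof of Theorem 2 (b) (p0008 L23–L49, the reduced dynamics near a regular equilibrium)] -/
theorem frame_eq_of_kronSolution {θs : Fin n → ℝ} {X Xs : ℝ → Fin n → ℝ}
    (hXs : ∀ T : ℝ, ∀ t ∈ Icc 0 T, HasDerivWithinAt Xs (N.kronField θs (Xs t)) (Icc 0 T) t)
    (hXsU : ∀ t, 0 ≤ t → IsUnit (N.lapLL (Xs t)).det)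
    (hXc : ContinuousOn X (Ici 0))
    (hXd : ∀ t, 0 < t → IsUnit (N.lapLL (X t)).det → HasDerivAt X (N.kronField θs (X t)) t)
    (h0 : X 0 = Xs 0) : ∀ t, 0 ≤ t → X t = Xs t := by
  set F : (Fin n → ℝ) → Fin n → ℝ := N.kronField θs with hF
  set O : Set (Fin n → ℝ) := {θ | (N.lapLL θ).det ≠ 0} with hO
  have hOopen : IsOpen O := isOpen_regular
  have hFO : ContDiffOn ℝ 1 F O := contDiffOn_kronField θs
  have hXsc : ∀ T, ContinuousOn Xs (Icc 0 T) := fun T t ht => (hXs T t ht).continuousWithinAt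
  by_contra hcon
  push Not at hcon
  obtain ⟨t₂, ht₂, hne₂⟩ := hcon
  set D : Set ℝ := {t | 0 ≤ t ∧ X t ≠ Xs t} with hD
  have hDne : D.Nonempty := ⟨t₂, ht₂, hne₂⟩
  have hDbdd : BddBelow D := ⟨0, fun t ht => ht.1⟩
  set t₁ : ℝ := sInf D with ht₁
  have ht₁0 : 0 ≤ t₁ := le_csInf hDne fun t ht => ht.1
  have hbefore : ∀ t, 0 ≤ t → t < t₁ → X t = Xs t := by
    intro t ht htt
    by_contra hne
    exact absurd (csInf_le hDbdd ⟨ht, hne⟩) (not_le.2 htt)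
  -- agreement at `t₁`
  have heq₁ : X t₁ = Xs t₁ := by
    rcases ht₁0.eq_or_lt with h | h
    · rw [← h]; exact h0
    · -- limit from the left of `X − X* = 0`
      have hc : ContinuousWithinAt (fun t => X t - Xs t) (Icc 0 t₁) t₁ :=
        ((hXc.mono fun t (ht : t ∈ Icc 0 t₁) => ht.1) t₁ ⟨h.le, le_rfl⟩).sub
          ((hXsc t₁) t₁ ⟨h.le, le_rfl⟩)
      have hIco : Ico 0 t₁ ⊆ Icc 0 t₁ := fun t ht => ⟨ht.1, ht.2.le⟩
      have htend : Tendsto (fun t => X t - Xs t) (𝓝[Ico 0 t₁] t₁) (𝓝 (X t₁ - Xs t₁)) :=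
        (hc.mono hIco).tendsto
      have hmem : t₁ ∈ closure (Ico 0 t₁) := by
        rw [closure_Ico h.ne]; exact right_mem_Icc.2 h.le
      haveI : (𝓝[Ico 0 t₁] t₁).NeBot := mem_closure_iff_nhdsWithin_neBot.1 hmem
      have hzero : Tendsto (fun t => X t - Xs t) (𝓝[Ico 0 t₁] t₁) (𝓝 0) := by
        refine tendsto_const_nhds.congr' ?_
        exact eventually_nhdsWithin_of_forall fun t ht => by
          show (0 : Fin n → ℝ) = X t - Xs t
          rw [hbefore t ht.1 ht.2, sub_self]
      exact sub_eq_zero.1 (tendsto_nhds_unique htend hzero)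
  -- a compact regular ball around `X*(t₁)` on which `F` is Lipschitz
  have hreg₁ : Xs t₁ ∈ O := (hXsU t₁ ht₁0).ne_zero
  obtain ⟨r, hr, hball⟩ := Metric.isOpen_iff.1 hOopen (Xs t₁) hreg₁
  set K : Set (Fin n → ℝ) := closedBall (Xs t₁) (r / 2) with hK
  have hKc : IsCompact K := isCompact_closedBall _ _
  have hKO : K ⊆ O := (closedBall_subset_ball (by linarith)).trans hball
  obtain ⟨C, hC⟩ := Literature.Analysis.ODE.exists_lipschitzOnWith_of_isCompact hOopen hFO hKc hKO
  -- continuity: both curves stay in `K` on `[t₁, t₁ + δ]`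
  have hXc₁ : ContinuousWithinAt X (Ici t₁) t₁ :=
    (hXc.mono fun t (ht : t ∈ Ici t₁) => ht₁0.trans ht) t₁ (mem_Ici.2 le_rfl)
  have hXsc₁ : ContinuousWithinAt Xs (Icc t₁ (t₁ + 1)) t₁ :=
    ((hXsc (t₁ + 1)).mono fun t (ht : t ∈ Icc t₁ (t₁ + 1)) => ⟨ht₁0.trans ht.1, ht.2⟩) t₁
      ⟨le_rfl, by linarith⟩
  obtain ⟨δ₁, hδ₁, hX₁⟩ : ∃ δ > 0, ∀ t ∈ Ici t₁, dist t t₁ < δ → dist (X t) (X t₁) < r / 2 :=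
    Metric.continuousWithinAt_iff.1 hXc₁ (r / 2) (by linarith)
  obtain ⟨δ₂, hδ₂, hXs₁⟩ : ∃ δ > 0, ∀ t ∈ Icc t₁ (t₁ + 1), dist t t₁ < δ →
      dist (Xs t) (Xs t₁) < r / 2 :=
    Metric.continuousWithinAt_iff.1 hXsc₁ (r / 2) (by linarith)
  set δ : ℝ := min (min δ₁ δ₂) 1 / 2 with hδ
  have hδpos : 0 < δ := by rw [hδ]; positivity
  have hδ1 : δ < δ₁ := by
    have := min_le_left (min δ₁ δ₂) 1; have := min_le_left δ₁ δ₂; rw [hδ]; linarith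
  have hδ2 : δ < δ₂ := by
    have := min_le_left (min δ₁ δ₂) 1; have := min_le_right δ₁ δ₂; rw [hδ]; linarith
  have hδone : δ < 1 := by have := min_le_right (min δ₁ δ₂) 1; rw [hδ]; linarith
  have hXK : ∀ t ∈ Icc t₁ (t₁ + δ), X t ∈ K := by
    intro t ht
    have hd : dist t t₁ < δ₁ := by
      rw [Real.dist_eq, abs_of_nonneg (by linarith [ht.1])]; linarith [ht.2]
    have h1 := hX₁ t ht.1 hd
    rw [heq₁] at h1
    exact mem_closedBall.2 h1.le
  have hXsK : ∀ t ∈ Icc t₁ (t₁ + δ), Xs t ∈ K := by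
    intro t ht
    have hd : dist t t₁ < δ₂ := by
      rw [Real.dist_eq, abs_of_nonneg (by linarith [ht.1])]; linarith [ht.2]
    exact mem_closedBall.2 (hXs₁ t ⟨ht.1, by linarith [ht.2]⟩ hd).le
  -- derivatives within `Ici t` on `[t₁, t₁ + δ)`
  have hXs' : ∀ t ∈ Ico t₁ (t₁ + δ), HasDerivWithinAt Xs (F (Xs t)) (Ici t) t := by
    intro t ht
    have h := hXs (t₁ + 1) t ⟨ht₁0.trans ht.1, by linarith [ht.2]⟩
    refine h.mono_of_mem_nhdsWithin ?_
    have hlt : t < t₁ + 1 := by linarith [ht.2]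
    exact mem_of_superset (Icc_mem_nhdsGE hlt) fun s hs => ⟨(ht₁0.trans ht.1).trans hs.1, hs.2⟩
  have hXder : ∀ t ∈ Ioo t₁ (t₁ + δ), HasDerivAt X (F (X t)) t := by
    intro t ht
    have htpos : 0 < t := lt_of_le_of_lt ht₁0 ht.1
    exact hXd t htpos (isUnit_iff_ne_zero.2 (hKO (hXK t ⟨ht.1.le, ht.2.le⟩)))
  -- the right derivative of `X` at `t₁` by continuous extension
  have hX₁' : HasDerivWithinAt X (F (X t₁)) (Ici t₁) t₁ := by
    have hs : Ioo t₁ (t₁ + δ) ∈ 𝓝[>] t₁ := Ioo_mem_nhdsGT (by linarith)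
    have f_diff : DifferentiableOn ℝ X (Ioo t₁ (t₁ + δ)) := fun t ht =>
      (hXder t ht).differentiableAt.differentiableWithinAt
    have f_lim : ContinuousWithinAt X (Ioo t₁ (t₁ + δ)) t₁ := hXc₁.mono fun t ht => ht.1.le
    have hFc : ContinuousAt F (X t₁) :=
      hFO.continuousOn.continuousAt (hOopen.mem_nhds (hKO (hXK t₁ ⟨le_rfl, by linarith⟩)))
    have hXlim : Tendsto X (𝓝[>] t₁) (𝓝 (X t₁)) :=
      (hXc₁.mono fun t (ht : t ∈ Ioi t₁) => (mem_Ioi.1 ht).le).tendsto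
    have f_lim' : Tendsto (fun t => deriv X t) (𝓝[>] t₁) (𝓝 (F (X t₁))) := by
      refine (hFc.tendsto.comp hXlim).congr' ?_
      filter_upwards [hs] with t ht
      exact ((hXder t ht).deriv).symm
    exact hasDerivWithinAt_Ici_of_tendsto_deriv f_diff f_lim hs f_lim'
  have hX' : ∀ t ∈ Ico t₁ (t₁ + δ), HasDerivWithinAt X (F (X t)) (Ici t) t := by
    intro t ht
    rcases ht.1.eq_or_lt with h | h
    · rw [← h]; exact hX₁'
    · exact (hXder t ⟨h, ht.2⟩).hasDerivWithinAt
  -- Grönwall on `[t₁, t₁ + δ]`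
  have hXcI : ContinuousOn X (Icc t₁ (t₁ + δ)) := hXc.mono fun t ht => ht₁0.trans ht.1
  have hXscI : ContinuousOn Xs (Icc t₁ (t₁ + δ)) :=
    (hXsc (t₁ + 1)).mono fun t ht => ⟨ht₁0.trans ht.1, by linarith [ht.2]⟩
  have hgr := dist_le_of_trajectories_ODE_of_mem (v := fun _ => F) (s := fun _ => K) (K := C)
    (f := X) (g := Xs) (a := t₁) (b := t₁ + δ) (δ := 0) (fun _ _ => hC) hXcI hX'
    (fun t ht => hXK t ⟨ht.1, ht.2.le⟩) hXscI hXs' (fun t ht => hXsK t ⟨ht.1, ht.2.le⟩)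
    (by rw [heq₁, dist_self])
  have hagree : ∀ t ∈ Icc t₁ (t₁ + δ), X t = Xs t := fun t ht => by
    have h := hgr t ht
    rw [zero_mul] at h
    exact dist_le_zero.1 h
  -- contradiction with the infimum
  obtain ⟨t₃, ht₃D, ht₃lt⟩ := exists_lt_of_csInf_lt hDne (show sInf D < t₁ + δ by linarith)
  exact ht₃D.2 (hagree t₃ ⟨csInf_le hDbdd ht₃D, ht₃lt.le⟩)

/-! ## §3 The DAE closed loop of Theorem 2 (i) with load nodes: trajectory uniqueness, and exactly
one solution from consistent data (the well-posedness the stability statement presupposes) -/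

/-- **UNIQUENESS of the solution of the differential-algebraic closed loop (KuraDroop)–(PowerBal)
near the synchronized solution of SPDB2013 Theorem 2 (i)** — the index-one DAE well-posedness that
«locally exponentially stable» presupposes (the print's «unique» in Theorem 2 (i) is the uniqueness of
the synchronized solution in `Δ_G(γ)`, a different statement, not claimed here).  Network (CombinedKuraDroop):
inverters `D_i > 0`, loads `D_i = 0` (algebraic power balance), at least one inverter, `|Y|`
symmetric; `θ*` an (Aux)-equilibrium with the real Hessian form `≥ 0` and kernel the constants (as in
the stability theorem).  Then there is `ρ > 0` such that for every initial condition `θ⁰` with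
`‖θ⁰ − θ*‖ < ρ`, any two maps `θ, θ' : ℝ → ℝⁿ` with `θ(0) = θ'(0) = θ⁰` that solve
(KuraDroop)/(PowerBal) at every `t > 0` (`IsSolutionAt`), satisfy the load constraints at every
`t ≥ 0` and are continuous on `[0, ∞)` coincide for all `t ≥ 0`.  MODEL: (KuraDroop)–(PowerBal),
lossless, constant voltages; classical solutions.
[cite: SimpsonporcoDorflerBullo2013, §3 Theorem 2 (i) («locally exponentially stable»: well-posedness presupposed) and proof of (b) (p0008 L23–L49); Khalil2002, Theorem 3.1] -/
theorem syncSolution_unique_loads (hY : ∀ i j, N.Yabs i j = N.Yabs j i) (hD : ∀ i, 0 ≤ N.Dc i)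
    (i₀ : N.Inv) {θ₀ : Fin n → ℝ} (hθ₀ : N.IsAuxEquilibrium θ₀)
    (hpsd : ∀ u : Fin n → ℝ, 0 ≤ ∑ i, u i * ∑ j, N.linWeight θ₀ i j * (u i - u j))
    (hker : ∀ u : Fin n → ℝ, ∑ i, u i * ∑ j, N.linWeight θ₀ i j * (u i - u j) = 0 →
      ∃ a : ℝ, u = fun _ => a) :
    ∃ ρ > 0, ∀ θinit : Fin n → ℝ, ‖θinit - θ₀‖ < ρ →
      ∀ θ θ' : ℝ → Fin n → ℝ, θ 0 = θinit → θ' 0 = θinit →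
        (∀ t : ℝ, 0 < t → N.IsSolutionAt θ t) → (∀ t : ℝ, 0 < t → N.IsSolutionAt θ' t) →
        (∀ t : ℝ, 0 ≤ t → ∀ l : N.Load, N.Pstar l.1 = N.injection (θ t) l.1) →
        (∀ t : ℝ, 0 ≤ t → ∀ l : N.Load, N.Pstar l.1 = N.injection (θ' t) l.1) →
        ContinuousOn θ (Ici 0) → ContinuousOn θ' (Ici 0) →
        ∀ t : ℝ, 0 ≤ t → θ t = θ' t := by
  classical
  obtain ⟨ρ, hρ, k, hk, lam, hlam, H⟩ := exists_kronSolution hY hD i₀ hθ₀ hpsd hker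
  refine ⟨ρ, hρ, fun θinit hinit θ θ' hθ0 hθ'0 hsol hsol' hcons hcons' hcont hcont' t ht => ?_⟩
  obtain ⟨Xs, hXs0, hXs, hXsU, -⟩ := H θinit hinit
  -- both frame curves coincide with the regular Kron solution
  have key : ∀ (φ : ℝ → Fin n → ℝ), φ 0 = θinit → (∀ t : ℝ, 0 < t → N.IsSolutionAt φ t) →
      (∀ t : ℝ, 0 ≤ t → ∀ l : N.Load, N.Pstar l.1 = N.injection (φ t) l.1) →
      ContinuousOn φ (Ici 0) →
      ∀ t, 0 ≤ t → (fun s j => φ s j - N.avgFrequency * s) t = Xs t := by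
    intro φ hφ0 hφsol hφcons hφcont
    set X : ℝ → Fin n → ℝ := fun s j => φ s j - N.avgFrequency * s with hXdef
    have hXc : ContinuousOn X (Ici 0) := by
      refine continuousOn_pi.2 fun j => ?_
      exact ((continuous_apply j).comp_continuousOn hφcont).sub
        ((continuous_const.mul continuous_id).continuousOn)
    have hL : ∀ (l : N.Load) (s : ℝ), 0 ≤ s → N.mismatch (X s) l.1 = 0 := fun l s hs =>
      frame_constraint hD (hφcons s hs) l
    have hXd : ∀ t, 0 < t → IsUnit (N.lapLL (X t)).det → HasDerivAt X (N.kronField θ₀ (X t)) t := by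
      intro t ht hU
      obtain ⟨V, hV, hVI⟩ := frame_hasDerivAt hD (hφsol t ht)
      exact hasDerivAt_kronField_of_forward ht hV hVI hL hU
    have h0 : X 0 = Xs 0 := by
      rw [hXs0, ← hφ0]; funext j; simp [hXdef]
    exact frame_eq_of_kronSolution hXs hXsU hXc hXd h0
  have h1 := key θ hθ0 hsol hcons hcont t ht
  have h2 := key θ' hθ'0 hsol' hcons' hcont' t ht
  funext j
  have h1j := congrFun h1 j
  have h2j := congrFun h2 j
  simp only at h1j h2j
  linarith

/-- **WELL-POSEDNESS OF THE DAE CLOSED LOOP OF THEOREM 2 (i) WITH LOAD NODES: exactly one solution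
from every consistent initial condition near the synchronized solution, and it converges
exponentially.**  With `ρ, k, λ`
there is, for every `θ⁰` with `‖θ⁰ − θ*‖ < ρ` satisfying the load constraints, a UNIQUE map
`θ : ℝ → ℝⁿ` in the class {`θ(0) = θ⁰`; (KuraDroop)/(PowerBal) at every `t > 0`; load constraints
at every `t ≥ 0`; continuous on `[0, ∞)`} up to its values at negative times — precisely: one such
`θ` exists, any two agree on `[0, ∞)` — and it satisfies
`‖θ(t) − (θ* + c𝟙 + ω_avg t𝟙)‖ ≤ k‖θ⁰ − (θ* + c𝟙)‖e^{−λt}`, `c = Σ D_i(θ⁰_i − θ*_i)/Σ D_i`.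
[cite: SimpsonporcoDorflerBullo2013, §3 Theorem 2 (i) and proof of (b); Teschl2012, Cor. 2.15] -/
theorem existsUnique_syncSolution_loads (hY : ∀ i j, N.Yabs i j = N.Yabs j i)
    (hD : ∀ i, 0 ≤ N.Dc i) (i₀ : N.Inv) {θ₀ : Fin n → ℝ} (hθ₀ : N.IsAuxEquilibrium θ₀)
    (hpsd : ∀ u : Fin n → ℝ, 0 ≤ ∑ i, u i * ∑ j, N.linWeight θ₀ i j * (u i - u j))
    (hker : ∀ u : Fin n → ℝ, ∑ i, u i * ∑ j, N.linWeight θ₀ i j * (u i - u j) = 0 →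
      ∃ a : ℝ, u = fun _ => a) :
    ∃ ρ > 0, ∃ k > 0, ∃ lam > 0, ∀ θinit : Fin n → ℝ, ‖θinit - θ₀‖ < ρ →
      (∀ l : N.Load, N.Pstar l.1 = N.injection θinit l.1) →
      ∃ θ : ℝ → Fin n → ℝ, (θ 0 = θinit ∧ (∀ t : ℝ, 0 < t → N.IsSolutionAt θ t) ∧
          (∀ t : ℝ, 0 ≤ t → ∀ l : N.Load, N.Pstar l.1 = N.injection (θ t) l.1) ∧
          ContinuousOn θ (Ici 0)) ∧
        (∀ θ' : ℝ → Fin n → ℝ, θ' 0 = θinit → (∀ t : ℝ, 0 < t → N.IsSolutionAt θ' t) →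
          (∀ t : ℝ, 0 ≤ t → ∀ l : N.Load, N.Pstar l.1 = N.injection (θ' t) l.1) →
          ContinuousOn θ' (Ici 0) → ∀ t : ℝ, 0 ≤ t → θ' t = θ t) ∧
        ∀ t : ℝ, 0 ≤ t →
          ‖θ t - fun i => θ₀ i + N.Dc ⬝ᵥ (θinit - θ₀) / (∑ i, N.Dc i) + N.avgFrequency * t‖
            ≤ k * ‖θinit - fun i => θ₀ i + N.Dc ⬝ᵥ (θinit - θ₀) / ∑ i, N.Dc i‖
              * Real.exp (-lam * t) := by
  obtain ⟨ρ₁, hρ₁, k, hk, lam, hlam, Hex⟩ := exists_syncSolution_loads hY hD i₀ hθ₀ hpsd hker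
  obtain ⟨ρ₂, hρ₂, Hun⟩ := syncSolution_unique_loads hY hD i₀ hθ₀ hpsd hker
  refine ⟨min ρ₁ ρ₂, lt_min hρ₁ hρ₂, k, hk, lam, hlam, fun θinit hinit hcons0 => ?_⟩
  obtain ⟨θ, hθ0, hsol, hcons, hcont, hest⟩ :=
    Hex θinit (lt_of_lt_of_le hinit (min_le_left _ _)) hcons0
  refine ⟨θ, ⟨hθ0, hsol, hcons, hcont⟩, fun θ' hθ'0 hsol' hcons' hcont' t ht => ?_, hest⟩
  exact Hun θinit (lt_of_lt_of_le hinit (min_le_right _ _)) θ' θ hθ'0 hθ0 hsol' hsol hcons' hcons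
    hcont' hcont t ht

end DroopNetwork

end Literature.MathematicalPhysics.PowerSystems
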